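import Summits.ResolutionOfSingularities.ResolutionOfSingularities.Theorems.MarkedTransferCampaignW46PlaneIsolated
import HarnessLib

/-!
# [OURS · L1 W4.6 rung (i-a)′] The FINITE-SEQUENCE exit bound — the EXIT-BOUND FORM, over FINITE permissible sequences, of
# the slot planner's word (res-plan-2 SLOT-PLANNER WORD 2026-08-27T01:06:33Z (1)(b)); RELABELLED 2026-08-27 on OURS-desk #71
# (docstring-only supersede; every Lean term unchanged): in iso-invariant finite-`Sing` regimes plausibly EQUIVALENT to
# `PermissiblyTerminates` by König's lemma (lanes' hand reading, not kernel-checked) — a PROOF-TARGET SHAPE for rung (i-a),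
# NOT a weaker rung (cell res-hironaka, LADDER-RESOLUTION rung L, D-0089; campaign s46; typed by res-L1-type-o1, the slot's
# OURS typer; host route MarkedTransfer, `--kind definition --supports stmt-ResolutionOfSingularities-16155`; companion of
# `MarkedTransferCampaignW46PlaneIsolated.lean`)

HONEST FRAMING. Nothing here is a statement of H. Hironaka's manuscript (2017-03-23, [Hironaka2017]) and nothing here asserts
that any statement of it holds. Everything is OURS (campaign definitions of cell res-hironaka) or pure logic over
res-L1-s46-pv-1's résumé-free reduction (`PermissibleRun`, `PermissiblyTerminates`, `LocalExitBound`,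
`permissiblyTerminates_of_localExitBound`). AI review is weaker than expert review. No `sorry`; axioms standard.

## Why this file, and the RELABEL (OURS-desk #40 → res-plan-2 01:06:33Z (1)(b) → OURS-desk #71)

`CampaignW46.LocalExitBound Rg` (companion, p477752 → relabelled p483951) bounds the number of stages meeting the fibre over
a point `x` for every INFINITE permissible sequence inside `Rg`; quantified over infinite runs it is implied by
`PermissiblyTerminates Rg` with `β ≡ 0` and hence EQUIVALENT to it in finite-`Sing` regimes (OURS-desk #40). The slot
planner's rung (i-a)′ (word (1)(b)): «RE-TYPE the target over FINITE permissible sequences — `β` bounding, for every FINITE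
run inside `Rg` and every `x`, the number of stages whose centre meets the fibre over `x`; `FinLocalExitBound →
PermissiblyTerminates` by the same pigeonhole, converse fails». This file TYPES that word VERBATIM (`FinLocalExitBound`) and
proves the easy direction of the sandwich.

RELABEL (OURS-desk #71, 2026-08-27; lane A res-L1-ref-a3 02:19:14Z PARTIAL, lane B res-L1-ref-b2 02:11:23Z / 02:28:13Z YES
with the same annotation; both: «repair is docstring-only, terms stay as proof targets»). The word's «converse fails» and
this file's earlier labels «genuinely weaker local item», «NOT implied by `PermissiblyTerminates Rg`» are WITHDRAWN as
UNSUPPORTED. The lanes' reading (a hand argument, NOT kernel-checked; its only delicate point is the iso-invariance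
bookkeeping): in a finite-`Sing` regime every §2.1-permissible centre is ONE closed point of `Sing(E)` (companion,
`IsPermissibleCentre.exists_eq_singleton_of_isolatedSing`), a blow-up is unique up to unique isomorphism (`IsBlowup`),
`hom` / `E_{k+1}` are forced by `hom_eq` / `E_succ`, and the regime predicates are iso-invariant — so the finite runs from a
fixed `(A₀, E₀)` form, modulo isomorphism, a FINITELY BRANCHING tree (`≤ #Sing(E_k)` children); `PermissiblyTerminates Rg`
(no infinite run; dependent choice turns an infinite branch into a run) and KÖNIG's lemma make that tree finite of some depth
`N(A₀, E₀)`, whence `#s ≤ len ≤ N` for every finite run: `PermissiblyTerminates Rg → FinLocalExitBound Rg` classically, with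
a non-constructive `β`. With `permissiblyTerminates_of_finLocalExitBound` below the sandwich is then FLAT:
`FinLocalExitBound ⟺ LocalExitBound ⟺ PermissiblyTerminates` in every iso-invariant finite-`Sing` regime. CONSEQUENCE FOR THE
SLOT: `FinLocalExitBound` is the UNIFORM-BOUND (exit-bound) FORM of the rung — the shape in which rung (i-a) is naturally
PROVED (an explicit bound / decreasing local invariant along quadratic-transform towers: finiteness of the infinitely-near
points over `x` with controlled order `≥ b`; Zariski / Abhyankar), not a weaker item to bank separately. On lane A's
alternative (β) «let `β` depend only on the germ at `x`»: a `β` depending only on NUMERICAL germ data `(ord_x J₀, b, dim)` is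
REFUTED by the towers of (VAC) below (arbitrarily many centres over `x` at fixed `(b, b, 2)`), and a `β` depending on the
full germ (completed stalk of `(Z₀, J₀)` at `x`) is again König-fed (blow-ups at the other singular points do not change
the germs over `x`) — so no re-typing is offered unless the slot planner / res-adj-8 words one; the EXPLICIT invariant is
proof content, not statement content.

## Contents (namespace `…Theorems.CampaignW46`)

* `FinPermissibleRun p K` — a FINITE §2.1-permissible sequence: the data of `PermissibleRun` (ambient data `A k`, ideal
  exponents `E k`, centres `D k`, blow-ups `π k`, ℕ-indexed) with a LENGTH `len` and the axioms (standard, permissible centre,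
  same base field, blow-up, controlled transform) required ONLY below `len` (`E k` standard for `k ≤ len`); the data beyond
  `len` are INERT (never constrained, never read by any decl below — DESIGN POINT (PAD)).
* `FinPermissibleRun.down m : Z_m ⟶ Z_0` — the composite of the first `m` blow-ups (verbatim `PermissibleRun.down`).
* `PermissibleRun.truncate r n` — the first `n` steps of an infinite run as a finite run (all fields carried, `len := n`).
* `FinLocalExitBound Rg` — **RUNG (i-a)′ in EXIT-BOUND FORM over finite runs** (word (1)(b) verbatim): `∃ β(A, E, x)`, for
  every FINITE permissible sequence `r` all of whose stages `0, …, len` lie in `Rg`, every point `x` of stage `0` and every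
  set `s` of stage indices `m < len` whose centre `D_m` meets the fibre of `Z_m → Z_0` over `x`: `#s ≤ β(A₀, E₀, x)`.
* `PlaneIsolatedFinLocalExitBound p K := FinLocalExitBound regimePlaneIsolated` — rung (i-a)′ in the regime of rung (i-a).
* Pure logic: `localExitBound_of_finLocalExitBound : FinLocalExitBound Rg → LocalExitBound Rg` (truncate the infinite run
  beyond `max s`), hence `permissiblyTerminates_of_finLocalExitBound` (finite-`Sing` regimes, via pv-1's pigeonhole assembly)
  and `planeIsolatedPermissiblyTerminates_of_finLocalExitBound` / `…TerminatesNabla_of_finLocalExitBound` — the proved half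
  `FinLocalExitBound ⇒ LocalExitBound ⇔ PermissiblyTerminates`; the converse `PermissiblyTerminates → FinLocalExitBound` is
  NOT proved here (classically it holds in iso-invariant finite-`Sing` regimes by König's lemma — the RELABEL above; not
  kernel-checked).

## DESIGN POINTS (for res-plan-2 / res-L1-s46-plan-1 on arrival / the next s46 prover / the OURS lanes)

* (PAD) ℕ-indexed data with a length rather than `Fin (len+1)`-indexed data: keeps `down`, `truncate` and the bridge to the
  companion literally parallel (`(r.truncate n).down = r.down` by `rfl`); an honest finite sequence extends to such data by
  repeating its last stage with identity maps (nothing below reads stages `> len`). The alternative `Fin`-indexed structure is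
  one reshaping away if a lane prefers it.
* (IDX) only stages `m < len` are counted (their centres `D_m` are the ones blown up); `Rg` is required at stages `0 … len`.
* (VAC) VACUITY (corrected on the RELABEL): the decl is not vacuous — finite runs exist in abundance (every truncation of every
  finite tower of permissible point blow-ups; runs with `len = 0` for every standard `E`, where the bound says `0 ≤ β`), and
  the towers along `(y^b − x^N)` in the plane (`N ≫ b`: `Sing = {0}` at every stage, `≈ N/b` point blow-ups over `x = 0`)
  are arbitrarily long at FIXED `(ord_x J₀, b, dim) = (b, b, 2)`, so `β` must really depend on `E₀` (not only on numerical
  germ data) — which the term allows. The earlier sentence «NOT implied by `PermissiblyTerminates Rg`» is WITHDRAWN (König,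
  OURS-desk #71, above): the decl is the exit-bound FORM of the rung and implies it (this file); it is not a weaker item.

## References

* res-plan-2, HOME/STATUS 2026-08-27T01:06:33Z SLOT-PLANNER WORD (1)(a)(b); OURS-desk #40 (res-L1-ref-a2 / res-L1-ref-b2,
  00:25–00:46Z); OURS-desk #71 (res-L1-ref-a3 02:19:14Z, res-L1-ref-b2 02:11:23Z / 02:28:13Z — the König reading recorded
  in the RELABEL); companion `MarkedTransferCampaignW46PlaneIsolated.lean` (res-L1-s46-pv-1; relabel p483951).
* D. Kőnig, *Über eine Schlussweise aus dem Endlichen ins Unendliche*, Acta Sci. Math. (Szeged) 3 (1927) 121–130 — the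
  infinity lemma invoked by the lanes; context only.
* O. Zariski, P. Samuel, *Commutative Algebra* II (1960), Appendix 5 (infinitely near points) — context only. [ZariskiSamuel1960]
-/

noncomputable section

set_option linter.dupNamespace false -- mandated namespace of this single-conjunct summit

open CategoryTheory AlgebraicGeometry TopologicalSpace

namespace Summit.ResolutionOfSingularities.ResolutionOfSingularities.Theorems

namespace CampaignW46

open Literature.AlgebraicGeometry.Resolution
open Literature.AlgebraicGeometry.Hironaka2017.S02Preliminaries
open Scheme.IdealSheafData

universe u

variable {p : ℕ} [Fact p.Prime] {K : Type u} [Field K] [CharP K p]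

/-! ## Finite permissible sequences -/

/-- [OURS · L1 W4.6 rung (i-a)′] NOT a statement of the manuscript. **A FINITE §2.1-permissible sequence** of length `len`
(`len` blow-ups, stages `0, …, len`): ambient data `A k` over `K`, ideal exponents `E k`, centres `D k`, blow-ups
`π k : Z_{k+1} ⟶ Z_k`, ℕ-indexed as in `PermissibleRun`, with the axioms required ONLY for the first `len` steps — `E k`
standard for `k ≤ len`; for `k < len`: `D k` a §2.1-permissible centre for `E k`, same base field, `π k` the blowing up
along the reduced ideal of `D k`, `E (k+1)` the controlled transform (Def. 2.1). Data beyond `len` are inert padding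
(DESIGN POINT (PAD)). [folklore] -/
structure FinPermissibleRun (p : ℕ) [Fact p.Prime] (K : Type u) [Field K] [CharP K p] where
  /-- the number of blow-ups -/
  len : ℕ
  /-- the ambient datum at stage `k` (meaningful for `k ≤ len`) -/
  A : ℕ → AmbientDatum p K
  /-- the ideal exponent at stage `k` -/
  E : ∀ k, IdealExponent (A k).Z
  /-- the centre blown up at stage `k` (meaningful for `k < len`) -/
  D : ∀ k, Closeds (A k).Z
  /-- the blow-up morphism `Z_{k+1} ⟶ Z_k` (meaningful for `k < len`) -/
  π : ∀ k, (A (k + 1)).Z ⟶ (A k).Z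
  /-- every `E k`, `k ≤ len`, is standard (`J ≠ (0)`, `b > 0`) -/
  standard : ∀ k, k ≤ len → (E k).IsStandard
  /-- the centre is permissible for `E k` (§2.1), `k < len` -/
  permissible : ∀ k, k < len → (E k).IsPermissibleCentre (A k).hom (D k)
  /-- same base field, `k < len` -/
  hom_eq : ∀ k, k < len → (A (k + 1)).hom = π k ≫ (A k).hom
  /-- `π k` is the blowing up along the reduced ideal of `D k`, `k < len` -/
  blowup : ∀ k, k < len → IsBlowup (π k) (vanishingIdeal (D k))
  /-- `E (k+1)` is the transform of `E k` (Def. 2.1), `k < len` -/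
  E_succ : ∀ k, k < len → E (k + 1) = (E k).transform (π k) (D k)

namespace FinPermissibleRun

variable (r : FinPermissibleRun p K)

/-- The composite `Z_m ⟶ Z_0` of the first `m` maps (verbatim `PermissibleRun.down`; meaningful for `m ≤ len`). [folklore] -/
def down : ∀ m : ℕ, (r.A m).Z ⟶ (r.A 0).Z
  | 0 => 𝟙 _
  | m + 1 => r.π m ≫ down m

end FinPermissibleRun

namespace PermissibleRun

variable (r : PermissibleRun p K)

/-- [OURS · L1 W4.6 rung (i-a)′] the first `n` steps of an infinite permissible sequence, as a finite one (all data carried;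
the axioms restricted). [folklore] -/
def truncate (n : ℕ) : FinPermissibleRun p K where
  len := n
  A := r.A
  E := r.E
  D := r.D
  π := r.π
  standard k _ := r.standard k
  permissible k _ := r.permissible k
  hom_eq k _ := r.hom_eq k
  blowup k _ := r.blowup k
  E_succ k _ := r.E_succ k

/-- Truncation does not change the composites `Z_m ⟶ Z_0`. [folklore] -/
theorem down_truncate (n m : ℕ) : (r.truncate n).down m = r.down m := by
  induction m with
  | zero => rfl
  | succ m ih =>
    show r.π m ≫ (r.truncate n).down m = r.π m ≫ r.down m
    rw [ih]
    rfl

end PermissibleRun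

/-! ## Rung (i-a)′: the local finite-sequence exit bound -/

/-- [OURS · L1 W4.6 rung (i-a)′] NOT a statement of the manuscript. **THE FINITE-SEQUENCE EXIT BOUND in the regime `Rg` —
EXIT-BOUND FORM over FINITE runs; in iso-invariant finite-`Sing` regimes plausibly EQUIVALENT to `PermissiblyTerminates Rg`
(König; lanes' reading on OURS-desk #71, not kernel-checked)** — types res-plan-2's SLOT-PLANNER WORD 2026-08-27T01:06:33Z
(1)(b) verbatim and replaces the role of the UNIFORM-BOUND SHAPE in which rung (i-a) (the termination clause of Th. 16.13
p.87 l.26–28 for surfaces with isolated singular locus, typed résumé-free as `PlaneIsolatedPermissiblyTerminates`) is to be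
PROVED: there is a function `β(A, E, x)` of a state and a point such that for every FINITE §2.1-permissible sequence `r` all
of whose stages `0, …, len` lie in `Rg`, every point `x` of its stage `0` and every finite set `s` of indices `m < len`
whose centre `D_m` meets the fibre of `Z_m → Z_0` over `x`: `#s ≤ β(A₀, E₀, x)`. It implies `LocalExitBound Rg`
(`localExitBound_of_finLocalExitBound`) and so, in finite-`Sing` regimes, the rung; the converse is not proved here.
RELABEL (docstring-only supersede 2026-08-27, res-L1-type-o1, OURS-desk #71: lane A res-L1-ref-a3 PARTIAL 02:19:14Z, lane B
res-L1-ref-b2 YES-with-annotation 02:28:13Z, same finding): the earlier labels «THE LOCAL ITEM … genuinely weaker», «NOT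
implied by `PermissiblyTerminates Rg`» are WITHDRAWN — by the lanes' König argument (module docstring) the decl is a
REFORMULATION of the rung in finite-`Sing` regimes, a proof target, NOT a weaker rung. VACUITY: module docstring (VAC).
Lean term unchanged. [folklore] -/
def FinLocalExitBound (Rg : Regime p K) : Prop :=
  ∃ β : ∀ A : AmbientDatum p K, IdealExponent A.Z → A.Z → ℕ,
    ∀ r : FinPermissibleRun p K, (∀ k, k ≤ r.len → Rg (r.A k) (r.E k)) →
      ∀ (x : (r.A 0).Z) (s : Finset ℕ),
        (∀ m ∈ s, m < r.len ∧ ∃ y ∈ (r.D m : Set (r.A m).Z), r.down m y = x) → s.card ≤ β (r.A 0) (r.E 0) x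

/-- [OURS · L1 W4.6 rung (i-a)′] NOT a statement of the manuscript. Rung (i-a)′ in the regime of rung (i-a) (surfaces with
isolated singular locus): `FinLocalExitBound regimePlaneIsolated` — the classical finiteness, uniform in the finite sequence,
of the infinitely near singular points over each `x` with controlled order `≥ b`; the EXIT-BOUND FORM in which the next s46
prover proves rung (i-a) (tree: `QuadraticTransforms*.lean`, `BaseTreeFinite.lean`). RELABEL (docstring-only supersede
2026-08-27, OURS-desk #71): plausibly EQUIVALENT to `PlaneIsolatedPermissiblyTerminates` — `→` is
`planeIsolatedPermissiblyTerminates_of_finLocalExitBound`, `←` classically by König's lemma (lanes' reading, not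
kernel-checked; see `FinLocalExitBound`); NOT a weaker rung. Lean term unchanged. [folklore] -/
def PlaneIsolatedFinLocalExitBound (p : ℕ) [Fact p.Prime] (K : Type u) [Field K] [CharP K p] : Prop :=
  FinLocalExitBound (regimePlaneIsolated (p := p) (K := K))

/-! ## Pure logic: the proved half `FinLocalExitBound ⇒ LocalExitBound (⇔ PermissiblyTerminates in finite-Sing regimes)` -/

/-- Pure logic: a finite-sequence bound bounds infinite sequences too — truncate the infinite run beyond the stages in `s`
(`PermissibleRun.truncate`, `down_truncate`). The converse is not proved here (classically it holds in iso-invariant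
finite-`Sing` regimes by König's lemma — RELABEL, OURS-desk #71, module docstring). [folklore] -/
theorem localExitBound_of_finLocalExitBound {Rg : Regime p K} (h : FinLocalExitBound Rg) : LocalExitBound Rg := by
  obtain ⟨β, hβ⟩ := h
  refine ⟨β, fun r hr x s hs => ?_⟩
  -- truncate at a length exceeding every index in `s`
  have key := hβ (r.truncate (s.sup id + 1)) (fun k _ => hr k) x s fun m hm => ?_
  · exact key
  · obtain ⟨y, hy, hyx⟩ := hs m hm
    refine ⟨Nat.lt_succ_of_le (Finset.le_sup (f := id) hm), y, hy, ?_⟩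
    rw [PermissibleRun.down_truncate]
    exact hyx

/-- Pure logic + the companion's pigeonhole assembly: in a regime all of whose states have finite singular locus, the local
finite-sequence bound excludes infinite permissible sequences. [folklore] -/
theorem permissiblyTerminates_of_finLocalExitBound {Rg : Regime p K}
    (hfin : ∀ (A : AmbientDatum p K) (E : IdealExponent A.Z), Rg A E → E.sing.Finite)
    (h : FinLocalExitBound Rg) : PermissiblyTerminates Rg :=
  permissiblyTerminates_of_localExitBound hfin (localExitBound_of_finLocalExitBound h)

/-- **Rung (i-a) from rung (i-a)′.** [folklore] -/
theorem planeIsolatedPermissiblyTerminates_of_finLocalExitBound (h : PlaneIsolatedFinLocalExitBound p K) :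
    PlaneIsolatedPermissiblyTerminates p K :=
  planeIsolatedPermissiblyTerminates_of_localExitBound (localExitBound_of_finLocalExitBound h)

/-- **The typed rungs (literal and ∇-centred, every notion instance) from rung (i-a)′.** [folklore] -/
theorem planeIsolatedTerminatesNabla_of_finLocalExitBound (h : PlaneIsolatedFinLocalExitBound p K) :
    PlaneIsolatedTerminates p K ∧ PlaneIsolatedTerminatesNabla p K :=
  planeIsolatedTerminatesNabla_of_localExitBound (localExitBound_of_finLocalExitBound h)

end CampaignW46

end Summit.ResolutionOfSingularities.ResolutionOfSingularities.Theorems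

end
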